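import Literature.AlgebraicGeometry.Frobenioids.DivisorialDescriptionsSections
import Literature.AlgebraicGeometry.Frobenioids.DegreeModelFrobenioid
import Literature.AlgebraicGeometry.Frobenioids.ModelFrobenioidTypeBridge
import Literature.AlgebraicGeometry.Frobenioids.ModelFrobenioidIsFrobenioid
import Mathlib.NumberTheory.Padics.PadicVal.Basic
import HarnessLib

/-!
# Frobenioids I, Theorem 5.1 (iv) as the INTERFACE-typed schema `Thm51iv_modelType F B` (FACT-LIST F-1071):
# the universal closure is false — a junk birationalization datum over a GENUINE unit-trivial Frobenioid

Mochizuki, *The geometry of Frobenioids I: the general theory*, Kyushu J. Math. **62** (2008)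
293–400, §5, Theorem 5.1 (iv), kurims text p. 97 ("Moreover, `C` is of model type"), proof p. 100 l. 2–5
("since `C` is of unit-trivial type, it follows immediately … that `C` is of birationally
Frobenius-normalized type, hence also of model type") [cite: MochizukiFrdI2008, Thm. 5.1 (iv) p.97].

PROOF-ONLY companion (cell abc-iut, block F fact-proving wave, seat abc-iut-f-025; FACT-LIST row
**F-1071** `PreFrobenioid.Thm51iv_modelType`, labelled «universal-closure REFUTED / schema» by the R7 kernel
TYPE-audit of abc-iut-w5-d199 WITHOUT a kernel object for the refutation) of
`DivisorialDescriptionsSections.lean` (seat abc-iut-L1-t5).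

The typed `Thm51iv_modelType F B := IsFrobenioid F → IsOfIsotropicType F → IsOfUnitTrivialType F →
IsOfPreModelType F ∧ IsOfBiratFrobeniusNormalizedType B` takes the birationalization datum `B` (the
data-only interface `BiratData`, carrying NO compatibility of Frobenius degrees) as a FREE parameter.  Its
universal closure is false at a GENUINE Frobenioid satisfying all three antecedents: abc-iut-L1-d4's model
Frobenioid `DegreeModel.C` of `(pt, ℕ, 0, 0)` ([FrdI] Thm. 5.2; a Frobenioid `DegreeModel.hF`, of isotropic
type `ModelFrobenioid.isOfIsotropicType`, and of UNIT-TRIVIAL type since an automorphism has Frobenius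
degree `1` and arrows are determined by their degree, `DegreeModel.isOfUnitTrivialType`).  Junk datum:
`C^birat := C`, `C → C^birat := 𝟭`, zero divisors, and Frobenius degrees TWISTED to the `2`-part
`2^{v₂(k)}` of the genuine degree `k` (a monoid homomorphism `ℕ⁺ → ℕ⁺`).  At the object `ι(−1)` of degree
`−1` the genuine endomorphisms are `(k, k − 1)`, one per `k ≥ 1`; the degree-`3` endomorphism `α` is then
"linear" for the junk degrees (`2^{v₂(3)} = 1`), so it lies in `O^▷(ι(−1)^birat)`, while the degree-`2`
endomorphism `φ` has junk degree `2`; Frobenius-normalization (Def. 1.2 (iv)) would demand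
`α² ∘ φ = φ ∘ α`, whose genuine degrees are `18 ≠ 6`:

* `DegreeModel.isOfUnitTrivialType` — `C` is of unit-trivial type;
* `DegreeModel.exists_junk_biratData_not_biratFrobeniusNormalized` — the witness datum;
* `PreFrobenioid.not_forall_thm51iv_modelType` — the universal closure (universe `0`) is FALSE (F-1071).

INSTANCE form (what consumers bind): abc-iut's `PreFrobenioid.thm51iv_modelType_biratData hF hsq :
Thm51iv_modelType F (biratData hF hsq)` — Thm. 5.1 (iv) at THE birationalization of every Frobenioid
(`UnitTrivialModelType.lean`, whose docstring already says "the statement is a schema in `B`, never to be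
quantified universally").  So the row is admissible ONLY at that instance (R5).  Refuted-closure ≠
refuted-paper; no definitions; no statement of the paper is strengthened; nothing here bears on
[IUTchIII] Cor. 3.12.
-/

noncomputable section

namespace Literature.AlgebraicGeometry.Frobenioids

open CategoryTheory

namespace DegreeModel

/-- The model Frobenioid of `(pt, ℕ, 0, 0)` is of UNIT-TRIVIAL type: an automorphism `α` of an object has
Frobenius degree `1` (degrees are multiplicative) and arrows are determined by domain, codomain and degree
(`hom_eq_of_degFr_eq`), so `α = id`. [cite: MochizukiFrdI2008, Thm. 5.2 (i) p.100] -/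
theorem isOfUnitTrivialType : PreFrobenioid.IsOfUnitTrivialType F := by
  intro A α hα
  apply Aut.ext
  exact hom_eq_of_degFr_eq _ _ hα.2

/-- **A junk `BiratData` over `C → F_Φ` against Thm. 5.1 (iv) as typed.**  `C^birat := C`, `C → C^birat := 𝟭`,
zero divisors, degrees `2^{v₂(k)}`; at `ι(−1)` the degree-`3` endomorphism is junk-linear, the degree-`2`
one has junk degree `2`, and `α² ∘ φ ≠ φ ∘ α` (genuine degrees `18 ≠ 6`), so `ι(−1)^birat` is not
Frobenius-normalized and the datum is NOT of birationally Frobenius-normalized type.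
[cite: MochizukiFrdI2008, Def. 4.5 (i) p.86] -/
theorem exists_junk_biratData_not_biratFrobeniusNormalized :
    ∃ B : PreFrobenioidData.BiratData.{0, 0, 0, 0, 0, 0} (PreFrobenioidData.ofFunctor natΦ F),
      ¬ PreFrobenioidData.IsOfBiratFrobeniusNormalizedType B := by
  let S₀ : PreFrobenioidData.{0} C D := PreFrobenioidData.ofFunctor natΦ F
  -- the `2`-part of a positive integer, as a monoid homomorphism `ℕ⁺ → ℕ⁺`
  let g : ℕ+ →* ℕ+ :=
    { toFun := fun k => ⟨2 ^ padicValNat 2 (k : ℕ), pow_pos two_pos _⟩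
      map_one' := PNat.eq (by simp)
      map_mul' := fun a b => PNat.eq (by
        simp only [PNat.mul_coe, PNat.mk_coe]
        rw [padicValNat.mul a.ne_zero b.ne_zero, pow_add]) }
  have hg3 : g 3 = 1 := PNat.eq (by
    show 2 ^ padicValNat 2 ((3 : ℕ+) : ℕ) = 1
    rw [padicValNat.eq_zero_of_not_dvd (by decide), pow_zero])
  have hg2 : ((g 2 : ℕ+) : ℕ) = 2 := by
    show 2 ^ padicValNat 2 ((2 : ℕ+) : ℕ) = 2
    rw [show ((2 : ℕ+) : ℕ) = 2 from rfl, padicValNat.self one_lt_two, pow_one]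
  -- the junk operations: zero divisors, degrees twisted by `g`
  let ops : PreFrobenioidData.{0} C D :=
    { base := S₀.base
      Mon := fun _ => PUnit
      pull := fun _ => MonoidHom.id _
      pull_id := fun _ _ => rfl
      pull_comp := fun _ _ _ => rfl
      div := fun _ => 1
      degFr := fun φ => g (S₀.degFr φ)
      div_id := fun _ => rfl
      div_comp := fun _ _ => rfl
      degFr_id := fun A => by rw [S₀.degFr_id, map_one]
      degFr_comp := fun ψ φ => by rw [S₀.degFr_comp, map_mul] }
  let B : PreFrobenioidData.BiratData.{0, 0, 0, 0, 0, 0} S₀ :=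
    { Birat := C
      toBirat := 𝟭 _
      obj_surjective := fun X => ⟨X, rfl⟩
      ops := ops
      ops_mon_eq_one := fun _ _ => rfl
      overBase := S₀.base.leftUnitor
      phiBirat := fun _ => ⊤
      divBirat := fun _ => 1
      divBirat_mem := fun _ _ => Subgroup.mem_top _ }
  refine ⟨B, fun h => ?_⟩
  -- the two endomorphisms of `ι(−1)`
  let α : End (ι (-1)) := homOf (ι (-1)) (ι (-1)) 3 (by rw [dg_ι]; decide)
  let φ : End (ι (-1)) := homOf (ι (-1)) (ι (-1)) 2 (by rw [dg_ι]; decide)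
  have hφ : ops.IsBaseIdentity φ := Subsingleton.elim _ _
  have hα : α ∈ ops.endSubmonoid (ι (-1)) := by
    refine ⟨Subsingleton.elim _ _, ?_⟩
    show g (S₀.degFr (homOf (ι (-1)) (ι (-1)) 3 _)) = 1
    exact hg3
  have key := h.obj (ι (-1)) φ hφ α hα
  -- `key : α ^ (ops.degFr φ) * φ = φ * α`; read off genuine Frobenius degrees
  have key' : α ^ ((g 2 : ℕ+) : ℕ) * φ = φ * α := key
  rw [hg2, pow_two, End.mul_def, End.mul_def, End.mul_def] at key'
  have k' := congrArg ModelFrobenioid.degFr key'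
  simp only [ModelFrobenioid.degFr_comp] at k'
  have k'' : (2 : ℕ+) * (3 * 3) = 3 * 2 := k'
  exact absurd k'' (by decide)

end DegreeModel

/-! ### The fully quantified closure, refuted at the model Frobenioid of `(pt, ℕ, 0, 0)` -/

/-- **FACT-LIST F-1071, universal closure REFUTED** (universe `0`; witness: `F` = the structure functor of
the model Frobenioid of `(pt, ℕ, 0, 0)` — a Frobenioid of isotropic and unit-trivial type — and the junk
datum of `DegreeModel.exists_junk_biratData_not_biratFrobeniusNormalized`).  The printed Thm. 5.1 (iv) is
the instance at THE birationalization, PROVED for every Frobenioid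
(`PreFrobenioid.thm51iv_modelType_biratData`). [cite: MochizukiFrdI2008, Thm. 5.1 (iv) p.97] -/
theorem PreFrobenioid.not_forall_thm51iv_modelType :
    ¬ ∀ (D : Type) [Category.{0} D] (Φ : Dᵒᵖ ⥤ CommMonCat.{0}) (C : Type) [Category.{0} C]
        (F : C ⥤ ElemFrobenioid Φ)
        (B : PreFrobenioidData.BiratData.{0, 0, 0, 0, 0, 0} (PreFrobenioidData.ofFunctor Φ F)),
        Literature.AlgebraicGeometry.Frobenioids.PreFrobenioid.Thm51iv_modelType F B := by
  intro h
  obtain ⟨B, hB⟩ := DegreeModel.exists_junk_biratData_not_biratFrobeniusNormalized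
  exact hB (h _ _ _ DegreeModel.F B DegreeModel.hF
    (ModelFrobenioid.isOfIsotropicType DegreeModel.objectwise_isGroupLike_B)
    DegreeModel.isOfUnitTrivialType).2

end Literature.AlgebraicGeometry.Frobenioids

end
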